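import Literature.RingTheory.FormalGroups.FormalOModuleLaw
import Literature.RingTheory.FormalGroups.FormalOModuleKernelIdeal
import Literature.RingTheory.FormalGroups.FormalOModuleKernelPoints
import Summits.HodgeConjecture.HodgeConjecture.Theorems.F0P6dStubHLA
import Mathlib.RingTheory.DiscreteValuationRing.Basic
import Mathlib.RingTheory.LocalRing.ResidueField.Defs
import Mathlib.RingTheory.Nilpotent.Basic
import HarnessLib

/-!
# `F0P6dFormalModuleKernels` — ★ RE-HOME (rung-0 re-homing task, books INVENTORY §8.4 M-3; LEAD F0P6-plan (g4) «M-72») of the crux workfile `Lines/F0_P6d_FormalModuleKernels.lean`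

This `Theorems/` module is the TREE BYTES of `Summits/HodgeConjecture/HodgeConjecture/Cruxes/HLiu418/Lines/F0_P6d_FormalModuleKernels.lean` (edition of record,
tree sha16 72720f19f7ff8e68, 152 l., code-`sorry`-free) with the NAMESPACE KEPT — `Summit.HodgeConjecture.HodgeConjecture.Cruxes.HLiu418.F0P6dFormalModuleKernels` — so that every
fully-qualified name (`HeightDichotomy`, `KernelIdealOfHeight`, `evalNilp`, `KernelPointsOfHeight`, `OrdSSKernels`, `stub_HLA`, `stub_HLB`, `stub_HLC`, `ordSSKernels_of_stubs`, `stub_HL_holds`; 10 declarations) is UNCHANGED; only this module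
docstring is re-headed.  Why a re-home: a `Theorems/` file cannot import a `Lines/` workfile (F0P6-ref1 o-6), and closing
stmt-HodgeConjecture-24832 `--as proved --by <Theorems decl>` at rung 0 needs the sorry-free Lines chain behind the gate (RE-HOME MAP v1.1, LA7-plan (g4),
2026-09-02; director g27 s1336 (R1)–(R3)).  It has NO `Lines` import (Tier 0).  Lines importers of the original: `F0_P6d_ConnectedBTDictionary`.
After this file is ★ the Lines workfile is meant to become a one-import SHIM of it (a `Lines/` write, batched per cone on the LEAD's word), so no
environment ever holds two copies (NO-CROSS-IMPORT rule, «M-72» (3)).  It asserts nothing beyond what the workfile already proves.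

## Original module docstring (verbatim)
# Crux `HLiu418` — P6 «MOD programme», door P″ (LEAD M-1 13:15:28Z) — SUB-LINE **F0-P6d FormalModuleKernels**:
# HEART's light formal-module inputs (b2) ORD ∕ (b3a) SS on the POWER-SERIES side

SKELETON v1 (F0P6d-plan (g0), 2026-09-01).  Cell `hodgecm-mathlib`, floor 0 (D-0183) ∕ D-0175 «LINES FIRST», programme P6, crux item
stmt-HodgeConjecture-24832 (`HCCMUnconditional.HLiu418`).  Under RULING M-1 the parent's boundary is MODv3 (pointwise congruence on
κ̄(w)-points, door P″); its XL core `stub_PWcore` (P6a) consumes HEART = the pointwise Frobenius dichotomy, whose finite-group-scheme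
inputs are LIGHT: (b1) connected–étale (P6b), **(b2) ORD: the connected part of `Ā[w^∞]` is a 1-dimensional formal `𝒪_w`-module of
`𝒪`-height 1, so `[ϖ](X) = g(X^q)`, `g′(0) ≠ 0` ⇒ `ker [ϖ] = ker F_q` AS SUBGROUP SCHEMES; (b3a) SS: `𝒪`-height 2 ⇒ `ker [ϖ] = ker F_{q²}`**
(this desk, split with F0P6b-plan 13:15:49Z ∕ 13:18:21Z), (b3b)(b4) (P6b).  HC_CM is proved only modulo the printed citations until rung 0
closes; nothing in this file is about HC: it registers named `stub_*` (each `sorry`, each a closed named `Prop` over ★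
`Literature.RingTheory.FormalGroups.FormalOModuleLaw` (p844456) and Mathlib) and one sorry-free composition.

## The letters (all on ★ `FormalOModuleLaw 𝒪 A`, `M.act ϖ = [ϖ]_F : FormalGroupHom F F`, ★ `FormalOModuleLaw.IsOfHeight M ϖ q h` =
«`[ϖ]_F(T) = u(T^{q^h})`, `u ∈ T·A⟦T⟧`, `u′(0) ∈ Aˣ`»)
* (HL-A) `HeightDichotomy` — NORMAL FORM over a field `k ⊇ 𝒪∕ϖ` (`𝒪` a DVR with finite residue field of cardinality `q`, `ϖ` a
  uniformiser, `ϖ ↦ 0` in `k`): `[ϖ]_F = 0` or `M.IsOfHeight ϖ q h` for some `h ≥ 1`.  (M: an endomorphism `f` of a formal group over an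
  `𝔽_p`-algebra with `f′(0) = 0` is `f₁(X^p)` (differentiate the hom identity; [Frohlich1968] I §3 Thm. 2, [Hazewinkel1978] (18.3.1));
  iterate by order; `𝒪`-linearity `[a]∘[ϖ] = [ϖ]∘[a]` on lowest terms gives `ā^{p^r} = ā` on `𝔽_q ⊆ k`, so `p^r` is a power of `q`
  ([HarrisTaylorAMS2001] §II.1 p. 59; [Drinfeld1974] §1).)
* (HL-B) `KernelIdealOfHeight` — KERNELS: `M.IsOfHeight ϖ q h` ⇒ for every `m`, `([ϖ^m]_F) = (X^{q^{hm}})` as ideals of `A⟦X⟧`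
  (`[ϖ](X) = X^{q^h}·(unit)`, compose; S–M) — i.e. `ker [ϖ^m] = ker F_{q^{hm}}` as closed subgroup schemes of `Spf A⟦X⟧`; ORD `h = 1`,
  `m = 1`: `ker [ϖ] = ker F_q`; SS `h = 2`: `ker [ϖ] = ker F_{q²}`.
* (HL-C) `KernelPointsOfHeight` — the same on NILPOTENT POINTS of `A`-algebras `R`: `[ϖ^m]_F(x) = 0 ↔ x^{q^{hm}} = 0` (S given HL-B).
* target `OrdSSKernels` + kernel-checked `ordSSKernels_of_stubs : HeightDichotomy → KernelIdealOfHeight → OrdSSKernels`.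
NOT in this file (named so nobody waits on this desk for them): which `h` occurs (`h = 1` iff `w`-ordinary, else `2` — HEART∕DICT, from the
CM type ∕ Kottwitz signature at `w`); the passage «connected part of the `w^∞`-torsion WITH its `𝒪_w`-action over `κ̄` ↦ a formal
`𝒪_w`-module LAW» (the field case of the banked BT ⟷ law dictionary `F0/P6/F0P6d-plan/F0_P6d_LubinTateFormalModuli.cand.v5.*` §2⅝ —
typed here as (HL-D) the day LEAD∕P6a name the carrier HEART quantifies over); (b1)(b3b)(b4) (P6b).

## Registered stubs (3) and head — ED. 3: ALL THREE CLOSED BY NAME (file sorry-free)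
`stub_HLA : HeightDichotomy` := ★ `Summit.HodgeConjecture.HodgeConjecture.Cruxes.HLiu418.F0P6dStubHLA.heightDichotomy` (`Theorems/F0P6dStubHLA.lean`,
A-p17 (g23) over ★ `FormalGroupHomFrobenius` p844727 (F0P6-p06) + ★ `FormalOModuleHeightOfFrobeniusForm` p844746; F0P6-p01's (iii) road) ·
`stub_HLB : KernelIdealOfHeight` := ★ `Literature.RingTheory.FormalGroups.FormalOModuleLaw.kernelIdealOfHeight` (p844621, F0P3b-p01) ·
`stub_HLC : KernelPointsOfHeight` := ★ `Literature.RingTheory.FormalGroups.FormalOModuleLaw.kernelPointsOfHeight` (p844675, F0P3b-p01; its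
`Literature.RingTheory.FormalGroups.evalNilp` (★ p844664) is this file's `evalNilp` text verbatim, so the fold is one token by `rfl`) ·
head `ordSSKernels_of_stubs` (sorry-free) and `stub_HL_holds : OrdSSKernels` — now a THEOREM (TRIO).  Sorries left: 0.

## REUSE MAP
★ `FormalGroups/FormalOModuleLaw` (`act`, `act_mul'` = composition, `coeff_one_act`, `IsOfHeight`, `algebraMap_eq_zero_of_isOfHeight`, `map`),
★ `FormalGroups/FormalGroupHom` (`comp_toPowerSeries`, `map`), Mathlib `RingTheory/PowerSeries/Expand` (`PowerSeries.expand p hp f = subst (X ^ p) f`,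
`expand_mul_eq_comp`) + `MvPowerSeries/Expand` (`map_iterateFrobenius_expand` — the `g(X^{p^r})` currency), `PowerSeries/Derivative` (`PowerSeries.derivative`,
for `f′ = 0 ⇒ f = g(X^p)` in characteristic `p`), `PowerSeries/Inverse` (`PowerSeries.isUnit_iff_constantCoeff`), `PowerSeries/Order`, `FieldTheory/Finite/Basic` (`FiniteField.pow_card`, `ZMod.pow_card`), `RingTheory/DiscreteValuationRing/Basic`,
`RingTheory/LocalRing/ResidueField`.

## References
* [Frohlich1968] A. Fröhlich, *Formal Groups*, LNM 74 (1968), Ch. I §3 Thm. 2 (bib ✓ lit1 batch 4).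
* [HarrisTaylorAMS2001] M. Harris, R. Taylor, *The geometry and cohomology of some simple Shimura varieties* (2001), §II.1 p. 59 (held chunks p0058–p0059).
* [Drinfeld1974] V. G. Drinfeld, *Elliptic modules*, §1 (not held; acq-15116∕7).
* [Hazewinkel1978] M. Hazewinkel, *Formal Groups and Applications*, §18.3, §21.1 (not held; acq-10149).
-/

set_option autoImplicit false
set_option linter.dupNamespace false

noncomputable section

namespace Summit.HodgeConjecture.HodgeConjecture.Cruxes.HLiu418.F0P6dFormalModuleKernels

universe u v

open Literature.RingTheory.FormalGroups (FormalGroupHom FormalOModuleLaw)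

/-! ## §1 The letters -/

/-- LETTER (HL-A) **HEIGHT DICHOTOMY ∕ NORMAL FORM** for one-dimensional formal `𝒪`-module laws over a field `k ⊇ 𝒪∕ϖ`: with
`𝒪` a DVR of finite residue field of cardinality `q` and `ϖ` a uniformiser mapping to `0` in `k`, either `[ϖ]_F = 0` or
`[ϖ]_F(T) = u(T^{q^h})` with `u′(0) ∈ kˣ` for some `h ≥ 1` (★ `FormalOModuleLaw.IsOfHeight M ϖ q h`). (M)
(print: Frohlich1968, Ch. I §3 Thm. 2) (print: HarrisTaylorAMS2001, §II.1 p. 59) -/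
def HeightDichotomy : Prop :=
  ∀ (𝒪 : Type u) [CommRing 𝒪] [IsDomain 𝒪] [IsDiscreteValuationRing 𝒪] [Finite (IsLocalRing.ResidueField 𝒪)] (ϖ : 𝒪),
    Irreducible ϖ → ∀ (k : Type v) [Field k] [Algebra 𝒪 k], algebraMap 𝒪 k ϖ = 0 →
      ∀ M : FormalOModuleLaw 𝒪 k,
        (M.act ϖ).toPowerSeries = 0 ∨ ∃ h, 0 < h ∧ M.IsOfHeight ϖ (Nat.card (IsLocalRing.ResidueField 𝒪)) h

/-- LETTER (HL-B) **KERNEL OF `[ϖ^m]` = KERNEL OF THE `q^{hm}`-FROBENIUS** (as closed subschemes of the formal group in its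
coordinate): if `[ϖ]_F(T) = u(T^{q^h})`, `u′(0)` a unit, then for every `m` the ideal of `A⟦X⟧` generated by `[ϖ^m]_F` is
`(X^{q^{hm}})` — ORD (`h = 1`): `ker [ϖ] = ker F_q`; SS (`h = 2`): `ker [ϖ] = ker F_{q²}`. (S–M: `[ϖ] = X^{q^h}·unit`, `[ϖ^m] = [ϖ]∘[ϖ^{m-1}]`
by ★ `act_mul'`, units of `A⟦X⟧` = unit constant coefficient.) (print: HarrisTaylorAMS2001, §II.1 p. 59) (print: Frohlich1968, Ch. I §3) -/
def KernelIdealOfHeight : Prop :=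
  ∀ (𝒪 : Type u) [CommRing 𝒪] (A : Type v) [CommRing A] [Algebra 𝒪 A] (M : FormalOModuleLaw 𝒪 A) (ϖ : 𝒪) (q h : ℕ),
    0 < q → M.IsOfHeight ϖ q h →
      ∀ m : ℕ, Ideal.span {(M.act (ϖ ^ m)).toPowerSeries} = Ideal.span {(PowerSeries.X : PowerSeries A) ^ (q ^ (h * m))}

open Classical in
/-- Evaluation of a one-variable power series over `A` at a NILPOTENT element `x` of an `A`-algebra `R`: the finite sum
`∑_{i<N} fᵢ xⁱ` (`x^N = 0`; independent of the witness), junk value `0` at a non-nilpotent `x`. -/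
def evalNilp {A : Type v} [CommRing A] {R : Type v} [CommRing R] [Algebra A R] (f : PowerSeries A) (x : R) : R :=
  if hx : IsNilpotent x then
    ∑ i ∈ Finset.range (Nat.find hx), algebraMap A R (PowerSeries.coeff i f) * x ^ i
  else 0

/-- LETTER (HL-C) **THE SAME ON NILPOTENT POINTS**: for a law of height `h` (normal form), a nilpotent `x` in an `A`-algebra
`R` satisfies `[ϖ^m]_F(x) = 0 ↔ x^{q^{hm}} = 0` — the functor-of-points form of HL-B (`evalNilp` is multiplicative on
nilpotents and sends series with unit constant coefficient to units). (S given HL-B) (print: HarrisTaylorAMS2001, §II.1 p. 59) -/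
def KernelPointsOfHeight : Prop :=
  ∀ (𝒪 : Type u) [CommRing 𝒪] (A : Type v) [CommRing A] [Algebra 𝒪 A] (M : FormalOModuleLaw 𝒪 A) (ϖ : 𝒪) (q h : ℕ),
    0 < q → M.IsOfHeight ϖ q h →
      ∀ (m : ℕ) (R : Type v) [CommRing R] [Algebra A R] (x : R), IsNilpotent x →
        (evalNilp (M.act (ϖ ^ m)).toPowerSeries x = 0 ↔ x ^ (q ^ (h * m)) = 0)

/-- TARGET LETTER **ORD ∕ SS KERNELS**: over a field `k ⊇ 𝒪∕ϖ`, a formal `𝒪`-module law with `[ϖ]_F ≠ 0` has a height `h ≥ 1`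
and `([ϖ^m]_F) = (X^{q^{hm}})` for all `m` (`q` = residue cardinality).  HEART reads it at `h = 1` (ordinary `w`) and `h = 2`
(supersingular `w`): `ker [ϖ] = ker F_q`, resp. `ker F_{q²}`, as subgroup schemes of the formal `𝒪_w`-module.
(print: HarrisTaylorAMS2001, §II.1 p. 59) -/
def OrdSSKernels : Prop :=
  ∀ (𝒪 : Type u) [CommRing 𝒪] [IsDomain 𝒪] [IsDiscreteValuationRing 𝒪] [Finite (IsLocalRing.ResidueField 𝒪)] (ϖ : 𝒪),
    Irreducible ϖ → ∀ (k : Type v) [Field k] [Algebra 𝒪 k], algebraMap 𝒪 k ϖ = 0 →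
      ∀ M : FormalOModuleLaw 𝒪 k, (M.act ϖ).toPowerSeries ≠ 0 →
        ∃ h, 0 < h ∧ M.IsOfHeight ϖ (Nat.card (IsLocalRing.ResidueField 𝒪)) h ∧
          ∀ m : ℕ, Ideal.span {(M.act (ϖ ^ m)).toPowerSeries} =
            Ideal.span {(PowerSeries.X : PowerSeries k) ^ (Nat.card (IsLocalRing.ResidueField 𝒪) ^ (h * m))}

/-! ## §2 Registered stubs -/

/-- (HL-A) registered stub — height dichotomy ∕ normal form over a field (M). [cite: Frohlich1968, Ch. I §3 Thm. 2] -/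
theorem stub_HLA : HeightDichotomy.{u, v} :=
  Summit.HodgeConjecture.HodgeConjecture.Cruxes.HLiu418.F0P6dStubHLA.heightDichotomy

/-- (HL-B) registered stub — `([ϖ^m]) = (X^{q^{hm}})` from the normal form (S–M). [cite: HarrisTaylorAMS2001, §II.1 p. 59] -/
theorem stub_HLB : KernelIdealOfHeight.{u, v} :=
  Literature.RingTheory.FormalGroups.FormalOModuleLaw.kernelIdealOfHeight

/-- (HL-C) registered stub — the points form (S). [cite: HarrisTaylorAMS2001, §II.1 p. 59] -/
theorem stub_HLC : KernelPointsOfHeight.{u, v} :=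
  Literature.RingTheory.FormalGroups.FormalOModuleLaw.kernelPointsOfHeight

/-! ## §3 Head (sorry-free composition) -/

/-- KERNEL-CHECKED COMPOSITION: dichotomy + kernel ideals ⇒ the ORD ∕ SS kernel statement (residue cardinality `q ≥ 1` because the
residue field is finite and nonempty). -/
theorem ordSSKernels_of_stubs (hA : HeightDichotomy.{u, v}) (hB : KernelIdealOfHeight.{u, v}) : OrdSSKernels.{u, v} := by
  intro 𝒪 _ _ _ _ ϖ hϖ k _ _ hk M hM
  rcases hA 𝒪 ϖ hϖ k hk M with h0 | ⟨h, hh, hM'⟩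
  · exact absurd h0 hM
  · have hq : 0 < Nat.card (IsLocalRing.ResidueField 𝒪) := Nat.card_pos
    exact ⟨h, hh, hM', hB 𝒪 k M ϖ _ h hq hM'⟩

/-- HEAD — `OrdSSKernels` from the registered stubs BY NAME (sorries only inside the stubs). -/
theorem stub_HL_holds : OrdSSKernels.{u, v} :=
  ordSSKernels_of_stubs stub_HLA stub_HLB

end Summit.HodgeConjecture.HodgeConjecture.Cruxes.HLiu418.F0P6dFormalModuleKernels
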